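import Mathlib
import Summits.Schanuel.Schanuel.Theses.RigidCore
import Summits.Schanuel.Schanuel.Theorems.AclSubsetLogFreeCore.Negative.LogFreeCoreCountable
import Summits.Schanuel.Schanuel.Theorems.RigidCoreSchanuelOnLogFreeCoreTowerReduction
import Summits.Schanuel.Schanuel.Theorems.RigidCoreSchanuelOnLogFreeCoreRelLWZeroOfCrux
import Summits.Schanuel.Schanuel.Theorems.RigidCoreSchanuelOnLogFreeCoreRelLWStepOfCrux
import Summits.Schanuel.Schanuel.Theorems.RigidCoreSchanuelOnLogFreeCoreLogFreeOfCrux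
import Summits.Schanuel.Schanuel.Theorems.RigidCoreSchanuelOnLogFreeCoreDiazAnyBase

/-!
# Crux `RigidCore.SchanuelOnLogFreeCore` (R), line `sector-split`, stub C22: Hermite–Lindemann relative to the kernel, along the whole core, under (R)

Support file for crux `stmt-Schanuel-0970`
(`Summit.Schanuel.Schanuel.Theses.RigidCore.SchanuelOnLogFreeCore`, "(R)": Schanuel's statement for
`ℚ`-linearly independent tuples from the log-free core `C_EA = logFreeCore`), registered stub
`stub_coreHL_of_crux` of skeleton v23b (lead c12, wave 2).

* `stub_coreHL_of_crux` (registered signature verbatim): **(R) ⟹ for `u ∈ C_EA`, if `eᵘ` is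
  algebraic over `ℚ(2πi, u)` then `u ∈ ℚ·2πi`** — Hermite–Lindemann RELATIVE TO THE KERNEL on the
  core (classical HL: `u ∈ ℚ̄ ∖ 0 ⟹ eᵘ ∉ ℚ(u)^{alg} = ℚ̄`).  This is the `r = 1` content of EVERY
  level of the kernel tower, uniformly, and is STRONGER than the rank-2 instance `(2πi, u)` of (R)
  (which gives `trdeg ℚ(π, u, eᵘ) ≥ 2` and hence nothing about `eᵘ` when `u` is transcendental over
  `ℚ(π)`): it uses that `u` is CONSTRUCTED.  PROOF — the induction of C20
  (`LogFreeOfCrux.level_zero / level_succ`, `…LogFreeOfCrux.lean`) with "algebraic over `ℚ`"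
  replaced by "algebraic over `ℚ(2πi, u) ≤ stage n`": at the minimal level `n = m + 1` of `u` the
  `r = 1` layer of `stub_relLWStep_of_crux` ((R) ⟹ RelLW_{m+1}) makes `eᵘ` transcendental over
  `stage (m+1) ⊇ ℚ(2πi, u)`; at level `0`, `eᵘ ∈ stage 0` (relatively algebraically closed) and the
  `r = 1` layer of `stub_relLWZero_of_crux` (`KernelTower.relLWZero_one_iff`) concludes.
* Consequences by the crux's name (namespace `CoreHL`): the transcendence form
  (`exp_transcendental_of_crux`); C20 `stub_logFree_of_crux` is the special case `eᵘ ∈ ℚ̄`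
  (`logFree_of_coreHL`); **(R) ⟹ `eᵉ` is transcendental over `ℚ(2πi, e)`**
  (`exp_exp_one_transcendental_of_crux`; compare the open first cell `eᵉ ∉ ℚ(π, e^{ℚ̄})^{alg}` of
  residue 2); **(R) ⟹ for `u ∈ C_EA ∖ ℚ·2πi`, `eᵘ ∉ ℚ(π, u)`-algebraic numbers**, in particular no
  `u ∈ C_EA` solves `eᵘ = p(u)` or `eᵘ = p(π, u)` for a non-trivial polynomial identity — the fixed
  points of `exp` (`eᵘ = u`) and the logarithms of `π` (`eᵘ = π`) are excluded from the core by the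
  same wave's worker stubs C23 `stub_fixedPoint_of_coreHL` (`…FixedPointCoreHL.lean`) and C24
  `stub_logPi_of_coreHL` (`…LogPiCoreHL.lean`), which take this file's conclusion as hypothesis
  (composed by name in the line's skeleton).

What is NOT claimed: (R) itself (open, `⊇ e ⊥ π`).  Sources: J. Kirby, *Exponential algebraicity in
exponential fields*, Bull. LMS 42 (2010), arXiv:0810.4285, Prop. 7.2 and §3; M. Bays, J. Kirby,
ANT 12 (2018), arXiv:1512.04262, §9; Ch. Hermite (1873) / F. Lindemann (1882) for the classical
statement being relativised.
-/

noncomputable section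

set_option linter.dupNamespace false

open Summit.Schanuel.Schanuel.Theses
open Summit.Schanuel.Schanuel.Theorems.AclSubsetLogFreeCore.Negative

namespace Summit.Schanuel.Schanuel.Theorems.RigidCore

namespace CoreHL

/-- `ℚ(2πi, u) ≤ stage n` whenever `u ∈ stage n` (`2πi ∈ stage 0 ≤ stage n`). [folklore] -/
theorem adjoin_le_stage {n : ℕ} {u : ℂ} (hu : u ∈ stage n) :
    IntermediateField.adjoin ℚ ({(2 * ↑Real.pi * Complex.I : ℂ), u} : Set ℂ) ≤ stage n := by
  rw [IntermediateField.adjoin_le_iff]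
  rintro x (rfl | rfl)
  · exact monotone_stage (Nat.zero_le n) two_pi_I_mem_stage_zero
  · exact hu

/-- Algebraic over `ℚ(2πi, u)` ⟹ algebraic over `stage n`, for `u ∈ stage n`. [folklore] -/
theorem isAlgebraic_stage_of_isAlgebraic_adjoin {n : ℕ} {u w : ℂ} (hu : u ∈ stage n)
    (hw : IsAlgebraic (↥(IntermediateField.adjoin ℚ ({(2 * ↑Real.pi * Complex.I : ℂ), u} : Set ℂ))) w) :
    IsAlgebraic (↥(stage n)) w :=
  isAlgebraic_of_le (adjoin_le_stage hu) hw

/-- **Level `0`**: under (R), if `u ∈ stage 0` and `eᵘ` is algebraic over `ℚ(2πi, u)`, then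
`u ∈ ℚ·2πi` (`eᵘ ∈ stage 0` by relative algebraic closedness; `r = 1` layer of
`stub_relLWZero_of_crux` through `KernelTower.relLWZero_one_iff`). [cite: Kirby2010, Prop. 7.2] -/
theorem level_zero (hR : RigidCore.SchanuelOnLogFreeCore) {u : ℂ} (hu : u ∈ stage 0)
    (halg : IsAlgebraic (↥(IntermediateField.adjoin ℚ ({(2 * ↑Real.pi * Complex.I : ℂ), u} : Set ℂ)))
      (Complex.exp u)) :
    u ∈ Submodule.span ℚ ({(2 * ↑Real.pi * Complex.I : ℂ)} : Set ℂ) := by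
  have h1 := KernelTower.relLWZero_one_iff.1.1 (stub_relLWZero_of_crux hR 1)
  have h2 := KernelTower.relLWZero_one_iff.2.1 h1
  exact h2 u hu (stage_closed 0 _ (isAlgebraic_stage_of_isAlgebraic_adjoin hu halg))

/-- **Level `m + 1` drops**: under (R), if `u ∈ stage (m+1)` and `eᵘ` is algebraic over
`ℚ(2πi, u)`, then `u ∈ stage m` (otherwise the `r = 1` layer of `stub_relLWStep_of_crux` makes `eᵘ`
transcendental over `stage (m+1) ⊇ ℚ(2πi, u)`). [cite: BaysKirby2018ANT, §9] -/
theorem level_succ (hR : RigidCore.SchanuelOnLogFreeCore) (m : ℕ) {u : ℂ} (hu : u ∈ stage (m + 1))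
    (halg : IsAlgebraic (↥(IntermediateField.adjoin ℚ ({(2 * ↑Real.pi * Complex.I : ℂ), u} : Set ℂ)))
      (Complex.exp u)) :
    u ∈ stage m := by
  by_contra hm
  have hai := stub_relLWStep_of_crux hR m 1 (fun _ => u) (fun _ => hu)
    (LogFreeOfCrux.linearIndependent_mkQ_of_not_mem hm)
  have ht : Transcendental (↥(stage (m + 1))) (Complex.exp u) :=
    (algebraicIndependent_singleton_iff (0 : Fin 1)).mp hai
  exact ht (isAlgebraic_stage_of_isAlgebraic_adjoin hu halg)

/-- **Every level** (induction on `n`: `level_succ` drops to `stage 0`, `level_zero` concludes). -/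
theorem level (hR : RigidCore.SchanuelOnLogFreeCore) :
    ∀ (n : ℕ) {u : ℂ}, u ∈ stage n →
      IsAlgebraic (↥(IntermediateField.adjoin ℚ ({(2 * ↑Real.pi * Complex.I : ℂ), u} : Set ℂ)))
        (Complex.exp u) →
      u ∈ Submodule.span ℚ ({(2 * ↑Real.pi * Complex.I : ℂ)} : Set ℂ)
  | 0, _, hu, halg => level_zero hR hu halg
  | n + 1, _, hu, halg => level hR n (level_succ hR n hu halg) halg

end CoreHL

/-- **Registered stub `stub_coreHL_of_crux` (C22) of line `sector-split` — (R) ⟹ Hermite–Lindemann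
relative to the kernel on the core** (signature verbatim): under Schanuel's statement for core
tuples, an element `u ∈ C_EA = logFreeCore` whose exponential is algebraic over `ℚ(2πi, u)` is a
rational multiple of `2πi`.  Core exhaustion `mem_logFreeCore_iff_exists_stage` + `CoreHL.level`.
[cite: Kirby2010, Prop. 7.2] [cite: BaysKirby2018ANT, §9] -/
theorem stub_coreHL_of_crux :
    RigidCore.SchanuelOnLogFreeCore →
      ∀ u : ℂ, u ∈ logFreeCore →
        IsAlgebraic (↥(IntermediateField.adjoin ℚ ({(2 * ↑Real.pi * Complex.I : ℂ), u} : Set ℂ)))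
            (Complex.exp u) →
          u ∈ Submodule.span ℚ ({(2 * ↑Real.pi * Complex.I : ℂ)} : Set ℂ) := by
  intro hR u hu halg
  obtain ⟨n, hn⟩ := mem_logFreeCore_iff_exists_stage.1 hu
  exact CoreHL.level hR n hn halg

namespace CoreHL

/-! ## Consequences by the crux's name -/

/-- **(R) ⟹ core Hermite–Lindemann, transcendence form**: for `u ∈ C_EA ∖ ℚ·2πi`, `eᵘ` is
transcendental over `ℚ(2πi, u)`. -/
theorem exp_transcendental_of_crux (hR : RigidCore.SchanuelOnLogFreeCore) {u : ℂ}
    (hu : u ∈ logFreeCore) (hnot : u ∉ Submodule.span ℚ ({(2 * ↑Real.pi * Complex.I : ℂ)} : Set ℂ)) :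
    Transcendental (↥(IntermediateField.adjoin ℚ ({(2 * ↑Real.pi * Complex.I : ℂ), u} : Set ℂ)))
      (Complex.exp u) :=
  fun h => hnot (stub_coreHL_of_crux hR u hu h)

/-- C20 (`stub_logFree_of_crux`, landed in `…LogFreeOfCrux.lean`) is the special case `eᵘ ∈ ℚ̄` of
core HL: algebraic over `ℚ` ⟹ algebraic over `ℚ(2πi, u)`.  Stated for the HYPOTHESIS shape of the
worker stubs C23/C24, so that any proof of core HL feeds them and C20 alike. -/
theorem logFree_of_coreHL
    (h : ∀ u : ℂ, u ∈ logFreeCore →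
        IsAlgebraic (↥(IntermediateField.adjoin ℚ ({(2 * ↑Real.pi * Complex.I : ℂ), u} : Set ℂ)))
            (Complex.exp u) →
          u ∈ Submodule.span ℚ ({(2 * ↑Real.pi * Complex.I : ℂ)} : Set ℂ))
    {u : ℂ} (hu : u ∈ logFreeCore) (halg : IsAlgebraic ℚ (Complex.exp u)) :
    u ∈ Submodule.span ℚ ({(2 * ↑Real.pi * Complex.I : ℂ)} : Set ℂ) := by
  set L : IntermediateField ℚ ℂ :=
    IntermediateField.adjoin ℚ ({(2 * ↑Real.pi * Complex.I : ℂ), u} : Set ℂ)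
  exact h u hu (halg.tower_top (L := L))

/-- `e = exp 1` is not on the kernel line (it is a non-zero real). [folklore] -/
theorem exp_one_not_mem_span_two_pi_I :
    Complex.exp 1 ∉ Submodule.span ℚ ({(2 * ↑Real.pi * Complex.I : ℂ)} : Set ℂ) := by
  intro hmem
  obtain ⟨q, hq⟩ := Submodule.mem_span_singleton.1 hmem
  rw [Rat.smul_def] at hq
  have hre := congrArg Complex.re hq
  have h1 : (Complex.exp 1).re = Real.exp 1 := by
    rw [show (1 : ℂ) = ((1 : ℝ) : ℂ) by simp, ← Complex.ofReal_exp, Complex.ofReal_re]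
  simp [h1] at hre
  exact (Real.exp_pos 1).ne' hre.symm

/-- **(R) ⟹ `eᵉ` is transcendental over `ℚ(2πi, e)`** (core HL at the core point `e = exp 1`;
with `e ∉ ℚ(π)^{alg}` — also an (R)-consequence, `e ⊥ π` — this is `trdeg ℚ(π, e, eᵉ) = 3`, (R) at
the core triple `(2πi, 1, e)`).  Compare the open first cell `eᵉ ∉ ℚ(π, e^{ℚ̄})^{alg}` of residue 2
and Schneider's open problem `eᵉ ∉ ℚ̄`. -/
theorem exp_exp_one_transcendental_of_crux (hR : RigidCore.SchanuelOnLogFreeCore) :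
    Transcendental
      (↥(IntermediateField.adjoin ℚ ({(2 * ↑Real.pi * Complex.I : ℂ), Complex.exp 1} : Set ℂ)))
      (Complex.exp (Complex.exp 1)) :=
  exp_transcendental_of_crux hR DiazAnyBase.exp_one_mem_logFreeCore exp_one_not_mem_span_two_pi_I

/-- **(R) ⟹ iterated exponentials stay off the kernel's algebraic shadow**: for every `u ∈ C_EA`
off the kernel line, `e^{eᵘ}` is transcendental over `ℚ(2πi, eᵘ)` as soon as `eᵘ ∉ ℚ·2πi`
(core HL at the core point `eᵘ`). -/
theorem exp_exp_transcendental_of_crux (hR : RigidCore.SchanuelOnLogFreeCore) {u : ℂ}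
    (hu : u ∈ logFreeCore)
    (hnot : Complex.exp u ∉ Submodule.span ℚ ({(2 * ↑Real.pi * Complex.I : ℂ)} : Set ℂ)) :
    Transcendental
      (↥(IntermediateField.adjoin ℚ ({(2 * ↑Real.pi * Complex.I : ℂ), Complex.exp u} : Set ℂ)))
      (Complex.exp (Complex.exp u)) :=
  exp_transcendental_of_crux hR (logFreeCore_mem_coreFamily.2.1 u hu) hnot

end CoreHL

end Summit.Schanuel.Schanuel.Theorems.RigidCore

end
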